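import Literature.Barriers.AtomisticToContinuum.StrongPinningBreathersExistence
import Literature.MathematicalPhysics.KineticTheory.LangevinChainConfinedLaSalle
import HarnessLib

/-!
# The Hairer–Mattingly chain: relaxation of the undriven chain, irreducibility, and the barrier fact from Theorem 5.6 plus one local minorisation

`Literature/Barriers/AtomisticToContinuum/` (D-0021 barrier catalogue), companion of
`StrongPinningBreathers.lean` (barrier fact `HairerMattingly2009_threeOscillators`: for the
three-oscillator chain with pinning `|q|^{2k}/2k`, `k > 3/2`, harmonic coupling and Langevin
baths, a Markov semigroup with EXACTLY ONE invariant probability measure). Hairer–Mattingly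
2009, §1: "the uniqueness of an invariant measure for a chain of arbitrary length follows quickly
from the hypoellipticity of the generator and the Hamiltonian structure once the existence of an
invariant measure is established" — asserted, not proved, in the paper. This file proves, for the
constructed semigroup `homogeneouslyPinnedChainSemigroup` (`StrongPinningBreathersSemigroup.lean`):

* `homogeneouslyPinnedChain_deriv_V_injective`, `homogeneouslyPinnedChain_eq_zero_of_dPotential_eq_zero`
  — the harmonic coupling force `V' = id` is injective and `0` is the only critical point of the
  potential `∑|q_i|^{2k}/2k + ∑(q_{i+1} - q_i)²/2` (`∑ q_i ∂_iΦ = ∑ |q_i|^{2k} + ∑ Δ² = 0 ⟹ q = 0`);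
* `homogeneouslyPinnedChain_tendsto_freeFlow_zero` — **LaSalle**: the undriven damped chain relaxes
  to `0` from every initial condition (`γ > 0`, any `N ≥ 1`), by
  `OscillatorChain.IsConfining.tendsto_freeFlow_zero` (`LangevinChainConfinedLaSalle.lean`);
* `homogeneouslyPinnedChain_langevinKernel_pos_of_mem_nhds_zero` — **irreducibility towards `0`**;
* `homogeneouslyPinnedChain_invariant_unique_of_localSmall` — **at most one invariant probability
  measure** given ONE local minorisation of the transition kernels near `0` (small sets +
  `invariant_unique_of_small_cover`);
* `HairerMattingly2009_threeOscillators_of_thm56_of_localSmall` — **the barrier fact follows from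
  the printed statement of Theorem 5.6 (`N = 3`) and one local minorisation near the equilibrium**,
  both taken as explicit hypotheses (neither is a named fact of the tree): existence by
  `homogeneouslyPinnedChain_exists_invariant_of_lyapunov` (Prop. 5.1, proved), uniqueness by the
  above. The local minorisation is the "hypoellipticity" input of HM §1; for non-integer `k` the
  coefficients are only finitely differentiable (HM §3.1), so a Hörmander-free (Malliavin /
  finite-dimensional skeleton) argument is the expected route to it.

## References

* M. Hairer, J. C. Mattingly, Comm. Pure Appl. Math. **62** (2009) 999–1032 (arXiv:0712.3884),
  Abstract, §1, §3.1, Prop. 5.1, Thm 5.6.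
* N. Cuneo, J.-P. Eckmann, M. Hairer, L. Rey-Bellet, EJP **23** (2018) no. 55, Props. 3.3, 3.6, 3.8.
-/

noncomputable section

open MeasureTheory ProbabilityTheory Filter Topology Set
open scoped NNReal ENNReal

namespace Literature.Barriers.AtomisticToContinuum.HeatConduction

open Literature.MathematicalPhysics.KineticTheory Literature.MathematicalPhysics.KineticTheory.HeatConduction

/-! ### The coupling force is injective; the origin is the only critical point -/

/-- `V'(r) = r` for the harmonic coupling of the Hairer–Mattingly chain. [folklore] -/
theorem homogeneouslyPinnedChain_deriv_V (k γ r : ℝ) : deriv (homogeneouslyPinnedChain k γ).V r = r := by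
  have hV : (homogeneouslyPinnedChain k γ).V = fun x => x ^ 2 / 2 := rfl
  rw [hV]
  have h : HasDerivAt (fun x : ℝ => x ^ 2 / 2) (2 * r ^ 1 * 1 / 2) r :=
    ((hasDerivAt_id r).pow 2).div_const 2
  rw [h.deriv]
  ring

/-- `V' = id` is injective. [folklore] -/
theorem homogeneouslyPinnedChain_deriv_V_injective (k γ : ℝ) :
    Function.Injective (deriv (homogeneouslyPinnedChain k γ).V) := by
  have h : deriv (homogeneouslyPinnedChain k γ).V = id := funext (homogeneouslyPinnedChain_deriv_V k γ)
  rw [h]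
  exact Function.injective_id

/-- **The only critical point of the Hairer–Mattingly potential is the origin** (`2k > 1`):
`∂_iΦ(q) = 0` for all `i` forces `q = 0`, since `∑ q_i ∂_iΦ(q) = ∑ |q_i|^{2k} + ∑_{bonds} Δ²`
(virial identity `OscillatorChain.sum_mul_dPotential`). [folklore] -/
theorem homogeneouslyPinnedChain_eq_zero_of_dPotential_eq_zero {k : ℝ} (hk : 1 < 2 * k) (γ : ℝ)
    (N : ℕ) (q : Fin N → ℝ) (h : ∀ i, (homogeneouslyPinnedChain k γ).dPotential N i q = 0) :
    q = 0 := by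
  have hsum : ∑ i, q i * (homogeneouslyPinnedChain k γ).dPotential N i q = 0 := by simp [h]
  rw [OscillatorChain.sum_mul_dPotential] at hsum
  simp only [homogeneouslyPinnedChain_deriv_U hk, homogeneouslyPinnedChain_deriv_V] at hsum
  have h1 : ∀ i, 0 ≤ q i * (|q i| ^ (2 * k - 2) * q i) := fun i => by
    have := Real.rpow_nonneg (abs_nonneg (q i)) (2 * k - 2)
    nlinarith [sq_nonneg (q i)]
  have h2 : 0 ≤ ∑ a : Fin N, ∑ l : Fin N,
      (if l.val = a.val + 1 then (q l - q a) * (q l - q a) else 0) :=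
    Finset.sum_nonneg fun a _ => Finset.sum_nonneg fun l _ => by
      split_ifs
      · exact mul_self_nonneg _
      · exact le_rfl
  have h3 : ∑ i, q i * (|q i| ^ (2 * k - 2) * q i) = 0 :=
    le_antisymm (by linarith [Finset.sum_nonneg fun i (_ : i ∈ Finset.univ) => h1 i])
      (Finset.sum_nonneg fun i _ => h1 i)
  have h4 := (Finset.sum_eq_zero_iff_of_nonneg fun i _ => h1 i).1 h3
  funext i
  have hi := h4 i (Finset.mem_univ i)
  by_contra hqi
  have hpos : 0 < |q i| ^ (2 * k - 2) := Real.rpow_pos_of_pos (abs_pos.2 hqi) _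
  have hsq : 0 < q i ^ 2 := by
    rw [← sq_abs]
    exact pow_pos (abs_pos.2 hqi) 2
  have : 0 < q i * (|q i| ^ (2 * k - 2) * q i) := by nlinarith
  linarith

/-! ### LaSalle, irreducibility, uniqueness for the Hairer–Mattingly chain -/

variable {k γ : ℝ} {N : ℕ} {T_L T_R : ℝ}

/-- **The undriven damped Hairer–Mattingly chain relaxes to its equilibrium**: for `k > 3/2`,
`γ > 0`, `N ≥ 1`, every trajectory of the zero-noise dynamics tends to `0` (LaSalle's invariance
principle, `OscillatorChain.IsConfining.tendsto_freeFlow_zero`). [cite: CuneoEckmannHairerReyBellet2018, Prop 3.3] -/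
theorem homogeneouslyPinnedChain_tendsto_freeFlow_zero (hk : 3 / 2 < k) (hγ : 0 < γ) (hN : 0 < N)
    (x : PhaseSpace N) :
    Tendsto (drivenFlow ((homogeneouslyPinnedChain k γ).drift N) x 0) atTop (𝓝 0) :=
  (homogeneouslyPinnedChain_isConfining hk hγ.le).tendsto_freeFlow_zero N (by exact hγ) hN
    (homogeneouslyPinnedChain_deriv_V_injective k γ)
    (fun q hq => homogeneouslyPinnedChain_eq_zero_of_dPotential_eq_zero (by linarith) γ N q hq) x

/-- **Irreducibility towards the equilibrium** for the transition kernels of the Hairer–Mattingly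
chain: every neighbourhood of `0` is reached from every point with positive probability at all
large times. [cite: CuneoEckmannHairerReyBellet2018, Prop 3.3] -/
theorem homogeneouslyPinnedChain_langevinKernel_pos_of_mem_nhds_zero (hk : 3 / 2 < k) (hγ : 0 < γ)
    (hN : 0 < N) (T_L T_R : ℝ) (z : PhaseSpace N) {G : Set (PhaseSpace N)}
    (hG : G ∈ 𝓝 (0 : PhaseSpace N)) :
    ∃ s₀ : ℝ≥0, ∀ t : ℝ≥0, s₀ ≤ t → 0 < (homogeneouslyPinnedChain k γ).langevinKernel N T_L T_R t z G :=
  (homogeneouslyPinnedChain_isConfining hk hγ.le).langevinKernel_pos_of_mem_nhds_zero N (by exact hγ) hN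
    (homogeneouslyPinnedChain_deriv_V_injective k γ)
    (fun q hq => homogeneouslyPinnedChain_eq_zero_of_dPotential_eq_zero (by linarith) γ N q hq) T_L T_R
    z hG

/-- **Uniqueness of the invariant probability measure of the Hairer–Mattingly semigroup from ONE
local minorisation near the equilibrium** (`k > 3/2`, `γ > 0`, `N ≥ 1`, `T_L, T_R ≥ 0`): an open
`G₀ ∋ 0`, a measure `ν₀` charging every neighbourhood of some point and a time window on which
`P_t(w, ·) ≥ ν₀` for `w ∈ G₀` force any two invariant probability measures to coincide
(`OscillatorChain.IsConfining.invariant_unique_of_localSmall`).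
[cite: CuneoEckmannHairerReyBellet2018, Prop 3.6 and Prop 3.8] -/
theorem homogeneouslyPinnedChain_invariant_unique_of_localSmall (hk : 3 / 2 < k) (hγ : 0 < γ)
    (hN : 0 < N) (hTL : 0 ≤ T_L) (hTR : 0 ≤ T_R)
    {G₀ : Set (PhaseSpace N)} (hG₀ : IsOpen G₀) (h0 : (0 : PhaseSpace N) ∈ G₀)
    {ν₀ : Measure (PhaseSpace N)} {y₀ : PhaseSpace N}
    (hy₀ : ∀ V : Set (PhaseSpace N), IsOpen V → y₀ ∈ V → 0 < ν₀ V)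
    {t₀ δ : ℝ} (hδ : 0 < δ) (hδt : δ ≤ t₀)
    (hloc : ∀ t : ℝ≥0, t₀ - δ ≤ (t : ℝ) → (t : ℝ) ≤ t₀ + δ → ∀ w ∈ G₀,
      ν₀ ≤ (homogeneouslyPinnedChain k γ).langevinKernel N T_L T_R t w)
    {μ ν : Measure (PhaseSpace N)} [IsProbabilityMeasure μ] [IsProbabilityMeasure ν]
    (hμ : (homogeneouslyPinnedChainSemigroup hk hγ.le hN hTL hTR).IsInvariant μ)
    (hν : (homogeneouslyPinnedChainSemigroup hk hγ.le hN hTL hTR).IsInvariant ν) : μ = ν :=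
  (homogeneouslyPinnedChain_isConfining hk hγ.le).invariant_unique_of_localSmall N (by exact hγ) hN
    (homogeneouslyPinnedChain_deriv_V_injective k γ)
    (fun q hq => homogeneouslyPinnedChain_eq_zero_of_dPotential_eq_zero (by linarith) γ N q hq) hTL hTR
    hG₀ h0 hy₀ hδ hδt hloc hμ hν

/-! ### The barrier fact from Theorem 5.6 and one local minorisation -/

/-- **`HairerMattingly2009_threeOscillators` from the printed statement of HM Theorem 5.6 and one
local minorisation near the equilibrium.** For every `k > 3/2`, `γ > 0`, `T_L, T_R > 0`: (i) if
Thm 5.6 holds as printed for the three-oscillator chain — a `C²` Lyapunov function `𝒱` with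
`𝒱 ≥ cH^α - C`, `L𝒱 ≤ C - cH^{α'}`, `c, C, α, α' > 0` — then the constructed semigroup has an
invariant probability measure (Prop. 5.1, proved: `homogeneouslyPinnedChain_exists_invariant_of_lyapunov`);
(ii) if moreover its transition kernels admit one local minorisation near `0` (the
"hypoellipticity" input of HM §1, in the small-set form of CEHR 2018 Props. 3.2/3.6), the invariant
probability measure is unique (`homogeneouslyPinnedChain_invariant_unique_of_localSmall`). Hence
the fact. Both inputs are explicit hypotheses, not named facts of the tree (D-0026).
[cite: HairerMattingly2009, Abstract and §1 and Thm 5.6 and Prop 5.1] -/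
theorem HairerMattingly2009_threeOscillators_of_thm56_of_localSmall
    (h56 : ∀ k γ : ℝ, 3 / 2 < k → 0 < γ → ∀ T_L T_R : ℝ, 0 < T_L → 0 < T_R →
      ∃ (𝒱 : PhaseSpace 3 → ℝ) (c C α α' : ℝ), ContDiff ℝ 2 𝒱 ∧ 0 < c ∧ 0 < C ∧ 0 < α ∧ 0 < α' ∧
        (∀ x, c * (homogeneouslyPinnedChain k γ).hamiltonian 3 x ^ α - C ≤ 𝒱 x) ∧
        (∀ x, (homogeneouslyPinnedChain k γ).generator 3 T_L T_R 𝒱 x ≤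
          C - c * (homogeneouslyPinnedChain k γ).hamiltonian 3 x ^ α'))
    (hloc : ∀ k γ : ℝ, 3 / 2 < k → 0 < γ → ∀ T_L T_R : ℝ, 0 < T_L → 0 < T_R →
      ∃ (G₀ : Set (PhaseSpace 3)) (ν₀ : Measure (PhaseSpace 3)) (y₀ : PhaseSpace 3) (t₀ δ : ℝ),
        IsOpen G₀ ∧ (0 : PhaseSpace 3) ∈ G₀ ∧
        (∀ V : Set (PhaseSpace 3), IsOpen V → y₀ ∈ V → 0 < ν₀ V) ∧ 0 < δ ∧ δ ≤ t₀ ∧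
        ∀ t : ℝ≥0, t₀ - δ ≤ (t : ℝ) → (t : ℝ) ≤ t₀ + δ → ∀ w ∈ G₀,
          ν₀ ≤ (homogeneouslyPinnedChain k γ).langevinKernel 3 T_L T_R t w) :
    HairerMattingly2009_threeOscillators := by
  intro k γ hk hγ T_L T_R hTL hTR
  have h3 : 0 < 3 := by norm_num
  obtain ⟨𝒱, c, C, α, α', h𝒱, hc, hC, hα, hα', hlow, hdrift⟩ := h56 k γ hk hγ T_L T_R hTL hTR
  obtain ⟨μ, hμP, hinv, -⟩ := homogeneouslyPinnedChain_exists_invariant_of_lyapunov hk hγ.le h3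
    hTL.le hTR.le h𝒱 hc hC hα hα' hlow hdrift 0
  obtain ⟨G₀, ν₀, y₀, t₀, δ, hG₀, h0, hy₀, hδ, hδt, hl⟩ := hloc k γ hk hγ T_L T_R hTL hTR
  refine ⟨homogeneouslyPinnedChainSemigroup hk hγ.le h3 hTL.le hTR.le, μ, ⟨hμP, hinv⟩, ?_⟩
  rintro ν ⟨hνP, hνinv⟩
  haveI := hνP
  haveI := hμP
  exact homogeneouslyPinnedChain_invariant_unique_of_localSmall hk hγ h3 hTL.le hTR.le hG₀ h0 hy₀ hδ
    hδt hl hνinv hinv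

/-- The same with the local minorisation in LEBESGUE form (`η · Leb|_{U₀} ≤ P_t(w, ·)` for `w ∈ G₀`,
`U₀` open nonempty, `η > 0`, `t` in a window) — the exact shape of hypothesis `hloc` of
`pinnedChain_minorization_of_localSmall` (`LangevinChainMinorization.lean`), i.e. what a
Hörmander-free partial-Malliavin argument produces. [cite: HairerMattingly2009, Abstract and §1] -/
theorem HairerMattingly2009_threeOscillators_of_thm56_of_lebesgueLocalSmall
    (h56 : ∀ k γ : ℝ, 3 / 2 < k → 0 < γ → ∀ T_L T_R : ℝ, 0 < T_L → 0 < T_R →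
      ∃ (𝒱 : PhaseSpace 3 → ℝ) (c C α α' : ℝ), ContDiff ℝ 2 𝒱 ∧ 0 < c ∧ 0 < C ∧ 0 < α ∧ 0 < α' ∧
        (∀ x, c * (homogeneouslyPinnedChain k γ).hamiltonian 3 x ^ α - C ≤ 𝒱 x) ∧
        (∀ x, (homogeneouslyPinnedChain k γ).generator 3 T_L T_R 𝒱 x ≤
          C - c * (homogeneouslyPinnedChain k γ).hamiltonian 3 x ^ α'))
    (hloc : ∀ k γ : ℝ, 3 / 2 < k → 0 < γ → ∀ T_L T_R : ℝ, 0 < T_L → 0 < T_R →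
      ∃ (G₀ U₀ : Set (PhaseSpace 3)) (η : ℝ≥0∞) (t₀ δ : ℝ), IsOpen G₀ ∧ (0 : PhaseSpace 3) ∈ G₀ ∧
        IsOpen U₀ ∧ U₀.Nonempty ∧ 0 < η ∧ 0 < δ ∧ δ ≤ t₀ ∧
        ∀ t : ℝ≥0, t₀ - δ ≤ (t : ℝ) → (t : ℝ) ≤ t₀ + δ → ∀ w ∈ G₀,
          η • (volume : Measure (PhaseSpace 3)).restrict U₀ ≤
            (homogeneouslyPinnedChain k γ).langevinKernel 3 T_L T_R t w) :
    HairerMattingly2009_threeOscillators :=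
  HairerMattingly2009_threeOscillators_of_thm56_of_localSmall h56 fun k γ hk hγ T_L T_R hTL hTR => by
    obtain ⟨G₀, U₀, η, t₀, δ, hG₀, h0, hU₀, ⟨y₀, hy₀⟩, hη, hδ, hδt, hmin⟩ :=
      hloc k γ hk hγ T_L T_R hTL hTR
    refine ⟨G₀, η • (volume : Measure (PhaseSpace 3)).restrict U₀, y₀, t₀, δ, hG₀, h0,
      fun V hV hyV => ?_, hδ, hδt, hmin⟩
    rw [Measure.smul_apply, Measure.restrict_apply hV.measurableSet, smul_eq_mul]
    exact ENNReal.mul_pos hη.ne' ((hV.inter hU₀).measure_pos volume ⟨y₀, hyV, hy₀⟩).ne'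

end Literature.Barriers.AtomisticToContinuum.HeatConduction

end
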